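import Literature.MathematicalPhysics.KineticTheory.HardSphereCollisionCampbell
import HarnessLib

/-!
# The Campbell / special-flow identity for hard spheres: assembly from three inputs

Topic `Literature/MathematicalPhysics/KineticTheory`. The named fact `HardSphereCampbellFormula`
(`HardSphereCollisionCampbell`: Liouville mean of a marked collision sum over `(0, τ]` = `τ ×` outgoing
contact flux of the mark, Cercignani–Illner–Pulvirenti 1994 App. 4.A) is reduced here to three inputs,
each a classical step of the special-flow computation, supplied by sibling files:

* `LB` — the FIRST-COLLISION LOWER BOUND `ofReal τ * Flux(g) ≤ ∫⁻ CPS_τ(g)` for every measurable mark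
  `g ≥ 0` (windows + single-collision events + the change of variables to collision coordinates);
* `UB` — the SHARP WINDOW UPPER BOUND `∫⁻ CPS_τ(g₀) ≤ ofReal τ * Flux(g₀) < ∞` for the flow-invariant
  energy-shell marks `g₀ = c · 1{E ≤ E₀}` (windows, Fatou, stationarity, exact one-window volume);
* `AEM` — almost-everywhere measurability of the collision pair sum of a measurable mark (Alexander's
  collision-by-collision dictionary).

From these: for a mark dominated by a shell mark, the lower bounds for `g` and `g₀ − g`, additivity of
both sides and the finite upper bound for `g₀` force equality (`lintegral_cps_eq_of_le_shell`); a general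
mark is the monotone limit of such marks (`min(g, n) · 1{E ≤ n}`), and monotone convergence on the
collision side together with monotonicity of the flux and the lower bound for `g` itself give the
identity (`hardSphereCampbellFormula_of`). No dynamics is used here beyond the finiteness of the collision
times of good orbits on bounded windows.

## References

* C. Cercignani, R. Illner, M. Pulvirenti, *The Mathematical Theory of Dilute Gases*, Springer (1994),
  App. 4.A pp. 107–111. [CIP1994]
-/

open MeasureTheory Set Function Filter
open scoped ENNReal NNReal RealInnerProductSpace

namespace Literature.MathematicalPhysics.KineticTheory

open Literature.Analysis.FluidPDE

noncomputable section

variable {d : Type*} [Fintype d] {N : ℕ} {ε : ℝ}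

/-! ### Algebra of the two sides -/

/-- A sandwich in `ℝ≥0∞`: `A ≤ a`, `B ≤ b`, `a + b ≤ A + B < ∞` force `a = A`. [folklore] -/
theorem eq_of_sandwich_ennreal {a b A B : ℝ≥0∞} (hA : A ≤ a) (hB : B ≤ b) (hab : a + b ≤ A + B)
    (hfin : A + B ≠ ⊤) : a = A := by
  have hBtop : B ≠ ⊤ := ne_top_of_le_ne_top hfin le_add_self
  refine le_antisymm ?_ hA
  have h : a + B ≤ A + B := (add_le_add le_rfl hB).trans hab
  exact (ENNReal.add_le_add_iff_right hBtop).1 h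

/-- The outgoing collision flux is monotone in the mark. [folklore] -/
theorem outgoingCollisionFlux_mono (ε : ℝ) (N : ℕ)
    {g g' : Config N d (UnitAddTorus d) → Fin N → Fin N → ℝ≥0∞} (h : ∀ w i j, g w i j ≤ g' w i j) :
    outgoingCollisionFlux ε N g ≤ outgoingCollisionFlux ε N g' := by
  unfold outgoingCollisionFlux
  refine Finset.sum_le_sum fun i _ => Finset.sum_le_sum fun j _ => ?_
  split_ifs
  · exact le_rfl
  · refine lintegral_mono fun z => lintegral_mono fun ω => mul_le_mul' le_rfl ?_
    exact indicator_le_indicator (h _ i j)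

/-- The contact insertion is jointly measurable in (configuration, direction). [folklore] -/
theorem measurable_contactInsert_prod (ε : ℝ) (i j : Fin N) :
    Measurable fun p : Config N d (UnitAddTorus d) × Metric.sphere (0 : EuclideanSpace ℝ d) 1 =>
      contactInsert ε i j (p.2 : EuclideanSpace ℝ d) p.1 := by
  unfold contactInsert
  have hx : Measurable fun p : Config N d (UnitAddTorus d) × Metric.sphere (0 : EuclideanSpace ℝ d) 1 =>
      ((p.1 j).1 + Literature.Analysis.FunctionSpaces.Torus.proj (ε • (p.2 : EuclideanSpace ℝ d)), (p.1 i).2) :=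
    ((measurable_fst.comp ((measurable_pi_apply j).comp measurable_fst)).add
      ((Literature.Analysis.FunctionSpaces.Torus.measurable_proj (d := d)).comp
        ((measurable_const_smul ε).comp (measurable_subtype_coe.comp measurable_snd)))).prodMk
      (measurable_snd.comp ((measurable_pi_apply i).comp measurable_fst))
  exact measurable_update'.comp (measurable_fst.prodMk hx)

/-- The integrand of the outgoing collision flux of a measurable mark is jointly measurable. [folklore] -/
theorem measurable_fluxIntegrand (ε : ℝ) {g : Config N d (UnitAddTorus d) → Fin N → Fin N → ℝ≥0∞}
    (hg : ∀ i j, Measurable fun w => g w i j) (i j : Fin N) :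
    Measurable fun p : Config N d (UnitAddTorus d) × Metric.sphere (0 : EuclideanSpace ℝ d) 1 =>
      ENNReal.ofReal (ε ^ (Fintype.card d - 1) * ⟪((p.2 : EuclideanSpace ℝ d)), (p.1 i).2 - (p.1 j).2⟫) *
        (hardSphereDomain (Torus.geometry d) N ε).indicator (fun w => g w i j)
          (contactInsert ε i j (p.2 : EuclideanSpace ℝ d) p.1) := by
  have hω : Measurable fun p : Config N d (UnitAddTorus d) × Metric.sphere (0 : EuclideanSpace ℝ d) 1 =>
      (p.2 : EuclideanSpace ℝ d) := measurable_subtype_coe.comp measurable_snd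
  have hv : ∀ k : Fin N, Measurable fun p : Config N d (UnitAddTorus d) ×
      Metric.sphere (0 : EuclideanSpace ℝ d) 1 => (p.1 k).2 :=
    fun k => measurable_snd.comp ((measurable_pi_apply k).comp measurable_fst)
  have h1 : Measurable fun p : Config N d (UnitAddTorus d) × Metric.sphere (0 : EuclideanSpace ℝ d) 1 =>
      ε ^ (Fintype.card d - 1) * ⟪((p.2 : EuclideanSpace ℝ d)), (p.1 i).2 - (p.1 j).2⟫ :=
    measurable_const.mul (hω.inner ((hv i).sub (hv j)))
  have hD : MeasurableSet (hardSphereDomain (Torus.geometry d) N ε) :=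
    measurableSet_hardSphereDomain _ Torus.measurable_geometry_sepVec N ε
  exact h1.ennreal_ofReal.mul (((hg i j).indicator hD).comp (measurable_contactInsert_prod ε i j))

/-- Additivity of the one-pair outgoing flux integral in the mark (measurable marks). [folklore] -/
theorem lintegral_fluxPair_add (ε : ℝ) {g g' : Config N d (UnitAddTorus d) → Fin N → Fin N → ℝ≥0∞}
    (hg : ∀ i j, Measurable fun w => g w i j) (i j : Fin N) :
    ∫⁻ z : Config N d (UnitAddTorus d), ∫⁻ ω : Metric.sphere (0 : EuclideanSpace ℝ d) 1,
        ENNReal.ofReal (ε ^ (Fintype.card d - 1) * ⟪((ω : EuclideanSpace ℝ d)), (z i).2 - (z j).2⟫) *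
          (hardSphereDomain (Torus.geometry d) N ε).indicator (fun w => g w i j + g' w i j)
            (contactInsert ε i j (ω : EuclideanSpace ℝ d) z) ∂(volume : Measure (EuclideanSpace ℝ d)).toSphere =
      (∫⁻ z : Config N d (UnitAddTorus d), ∫⁻ ω : Metric.sphere (0 : EuclideanSpace ℝ d) 1,
        ENNReal.ofReal (ε ^ (Fintype.card d - 1) * ⟪((ω : EuclideanSpace ℝ d)), (z i).2 - (z j).2⟫) *
          (hardSphereDomain (Torus.geometry d) N ε).indicator (fun w => g w i j)
            (contactInsert ε i j (ω : EuclideanSpace ℝ d) z) ∂(volume : Measure (EuclideanSpace ℝ d)).toSphere) +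
      ∫⁻ z : Config N d (UnitAddTorus d), ∫⁻ ω : Metric.sphere (0 : EuclideanSpace ℝ d) 1,
        ENNReal.ofReal (ε ^ (Fintype.card d - 1) * ⟪((ω : EuclideanSpace ℝ d)), (z i).2 - (z j).2⟫) *
          (hardSphereDomain (Torus.geometry d) N ε).indicator (fun w => g' w i j)
            (contactInsert ε i j (ω : EuclideanSpace ℝ d) z) ∂(volume : Measure (EuclideanSpace ℝ d)).toSphere := by
  haveI : SFinite ((volume : Measure (EuclideanSpace ℝ d)).toSphere) := inferInstance
  have hm1 : Measurable fun z : Config N d (UnitAddTorus d) => ∫⁻ ω : Metric.sphere (0 : EuclideanSpace ℝ d) 1,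
      ENNReal.ofReal (ε ^ (Fintype.card d - 1) * ⟪((ω : EuclideanSpace ℝ d)), (z i).2 - (z j).2⟫) *
        (hardSphereDomain (Torus.geometry d) N ε).indicator (fun w => g w i j)
          (contactInsert ε i j (ω : EuclideanSpace ℝ d) z) ∂(volume : Measure (EuclideanSpace ℝ d)).toSphere :=
    (measurable_fluxIntegrand ε hg i j).lintegral_prod_right'
  have hinner : ∀ z : Config N d (UnitAddTorus d),
      ∫⁻ ω : Metric.sphere (0 : EuclideanSpace ℝ d) 1,
        ENNReal.ofReal (ε ^ (Fintype.card d - 1) * ⟪((ω : EuclideanSpace ℝ d)), (z i).2 - (z j).2⟫) *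
          (hardSphereDomain (Torus.geometry d) N ε).indicator (fun w => g w i j + g' w i j)
            (contactInsert ε i j (ω : EuclideanSpace ℝ d) z) ∂(volume : Measure (EuclideanSpace ℝ d)).toSphere =
      (∫⁻ ω : Metric.sphere (0 : EuclideanSpace ℝ d) 1,
        ENNReal.ofReal (ε ^ (Fintype.card d - 1) * ⟪((ω : EuclideanSpace ℝ d)), (z i).2 - (z j).2⟫) *
          (hardSphereDomain (Torus.geometry d) N ε).indicator (fun w => g w i j)
            (contactInsert ε i j (ω : EuclideanSpace ℝ d) z) ∂(volume : Measure (EuclideanSpace ℝ d)).toSphere) +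
      ∫⁻ ω : Metric.sphere (0 : EuclideanSpace ℝ d) 1,
        ENNReal.ofReal (ε ^ (Fintype.card d - 1) * ⟪((ω : EuclideanSpace ℝ d)), (z i).2 - (z j).2⟫) *
          (hardSphereDomain (Torus.geometry d) N ε).indicator (fun w => g' w i j)
            (contactInsert ε i j (ω : EuclideanSpace ℝ d) z) ∂(volume : Measure (EuclideanSpace ℝ d)).toSphere := by
    intro z
    have hω : Measurable fun ω : Metric.sphere (0 : EuclideanSpace ℝ d) 1 => (ω : EuclideanSpace ℝ d) :=
      measurable_subtype_coe
    have hci : Measurable fun ω : Metric.sphere (0 : EuclideanSpace ℝ d) 1 =>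
        contactInsert ε i j (ω : EuclideanSpace ℝ d) z := by
      unfold contactInsert
      exact (measurable_update z).comp ((measurable_const.add
        ((Literature.Analysis.FunctionSpaces.Torus.measurable_proj (d := d)).comp
          ((measurable_const_smul ε).comp hω))).prodMk measurable_const)
    have hD : MeasurableSet (hardSphereDomain (Torus.geometry d) N ε) :=
      measurableSet_hardSphereDomain _ Torus.measurable_geometry_sepVec N ε
    have hm2 : Measurable fun ω : Metric.sphere (0 : EuclideanSpace ℝ d) 1 =>
        ENNReal.ofReal (ε ^ (Fintype.card d - 1) * ⟪((ω : EuclideanSpace ℝ d)), (z i).2 - (z j).2⟫) *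
          (hardSphereDomain (Torus.geometry d) N ε).indicator (fun w => g w i j)
            (contactInsert ε i j (ω : EuclideanSpace ℝ d) z) :=
      (measurable_const.mul (hω.inner measurable_const)).ennreal_ofReal.mul
        (((hg i j).indicator hD).comp hci)
    calc _ = ∫⁻ ω : Metric.sphere (0 : EuclideanSpace ℝ d) 1,
          (ENNReal.ofReal (ε ^ (Fintype.card d - 1) * ⟪((ω : EuclideanSpace ℝ d)), (z i).2 - (z j).2⟫) *
            (hardSphereDomain (Torus.geometry d) N ε).indicator (fun w => g w i j)
              (contactInsert ε i j (ω : EuclideanSpace ℝ d) z) +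
          ENNReal.ofReal (ε ^ (Fintype.card d - 1) * ⟪((ω : EuclideanSpace ℝ d)), (z i).2 - (z j).2⟫) *
            (hardSphereDomain (Torus.geometry d) N ε).indicator (fun w => g' w i j)
              (contactInsert ε i j (ω : EuclideanSpace ℝ d) z)) ∂(volume : Measure (EuclideanSpace ℝ d)).toSphere := by
          refine lintegral_congr fun ω => ?_
          rw [← mul_add]
          congr 1
          by_cases hD : contactInsert ε i j (ω : EuclideanSpace ℝ d) z ∈ hardSphereDomain (Torus.geometry d) N ε
          · simp only [indicator_of_mem hD]
          · simp only [indicator_of_notMem hD, add_zero]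
      _ = _ := lintegral_add_left hm2 _
  calc _ = ∫⁻ z : Config N d (UnitAddTorus d), ((∫⁻ ω : Metric.sphere (0 : EuclideanSpace ℝ d) 1,
        ENNReal.ofReal (ε ^ (Fintype.card d - 1) * ⟪((ω : EuclideanSpace ℝ d)), (z i).2 - (z j).2⟫) *
          (hardSphereDomain (Torus.geometry d) N ε).indicator (fun w => g w i j)
            (contactInsert ε i j (ω : EuclideanSpace ℝ d) z) ∂(volume : Measure (EuclideanSpace ℝ d)).toSphere) +
      ∫⁻ ω : Metric.sphere (0 : EuclideanSpace ℝ d) 1,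
        ENNReal.ofReal (ε ^ (Fintype.card d - 1) * ⟪((ω : EuclideanSpace ℝ d)), (z i).2 - (z j).2⟫) *
          (hardSphereDomain (Torus.geometry d) N ε).indicator (fun w => g' w i j)
            (contactInsert ε i j (ω : EuclideanSpace ℝ d) z) ∂(volume : Measure (EuclideanSpace ℝ d)).toSphere) :=
        lintegral_congr hinner
    _ = _ := lintegral_add_left hm1 _

/-- The outgoing collision flux is additive in the mark (measurable marks). [folklore] -/
theorem outgoingCollisionFlux_add (ε : ℝ) (N : ℕ)
    {g g' : Config N d (UnitAddTorus d) → Fin N → Fin N → ℝ≥0∞} (hg : ∀ i j, Measurable fun w => g w i j) :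
    outgoingCollisionFlux ε N (fun w i j => g w i j + g' w i j) =
      outgoingCollisionFlux ε N g + outgoingCollisionFlux ε N g' := by
  unfold outgoingCollisionFlux
  rw [← Finset.sum_add_distrib]
  refine Finset.sum_congr rfl fun i _ => ?_
  rw [← Finset.sum_add_distrib]
  refine Finset.sum_congr rfl fun j _ => ?_
  split_ifs
  · exact (add_zero _).symm
  · exact lintegral_fluxPair_add ε hg i j

/-! ### The collision side on good orbits -/

section Good

variable {G : Geometry d (UnitAddTorus d)} (Φ : HardSphereFlow G ε N)

/-- On a good orbit the collision times in `(0, τ]` are finitely many. [folklore] -/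
theorem finite_collisionTimes_Ioc {z : Config N d (UnitAddTorus d)} (hz : z ∈ Φ.good) (τ : ℝ) :
    (collisionTimes G ε (fun t => Φ.flow t z) ∩ Ioc 0 τ).Finite :=
  ((Φ.isTrajectory z hz).locFinite 0 τ).subset (inter_subset_inter_right _ Ioc_subset_Icc_self)

/-- Additivity of the collision pair sum of a good orbit in the mark. [folklore] -/
theorem collisionPairSum_add_good {z : Config N d (UnitAddTorus d)} (hz : z ∈ Φ.good) (τ : ℝ)
    (g g' : Config N d (UnitAddTorus d) → Fin N → Fin N → ℝ≥0∞) :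
    Φ.collisionPairSum (Ioc 0 τ) (fun _ w i j => g w i j + g' w i j) z =
      Φ.collisionPairSum (Ioc 0 τ) (fun _ w i j => g w i j) z +
        Φ.collisionPairSum (Ioc 0 τ) (fun _ w i j => g' w i j) z :=
  collisionPairSum_add (finite_collisionTimes_Ioc Φ hz τ) _ _

/-- Monotone convergence of the collision pair sum of a good orbit in the mark: for marks `gₙ ↑ g`
pointwise, `⨆ₙ CPS(gₙ) = CPS(g)` (a finite sum of monotone limits). [folklore] -/
theorem iSup_collisionPairSum_good {z : Config N d (UnitAddTorus d)} (hz : z ∈ Φ.good) (τ : ℝ)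
    (gs : ℕ → Config N d (UnitAddTorus d) → Fin N → Fin N → ℝ≥0∞) (hmono : ∀ w i j, Monotone fun n => gs n w i j)
    (g : Config N d (UnitAddTorus d) → Fin N → Fin N → ℝ≥0∞) (hsup : ∀ w i j, ⨆ n, gs n w i j = g w i j) :
    ⨆ n, Φ.collisionPairSum (Ioc 0 τ) (fun _ w i j => gs n w i j) z =
      Φ.collisionPairSum (Ioc 0 τ) (fun _ w i j => g w i j) z := by
  have hfin := finite_collisionTimes_Ioc Φ hz τ
  unfold HardSphereFlow.collisionPairSum
  simp only [collisionPairSum_eq_finset_sum hfin]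
  rw [← ENNReal.finsetSum_iSup_of_monotone
    (f := fun (t : ℝ) n => ∑ p ∈ contactPairs G ε (Φ.flow t z), gs n (Φ.flow t z) p.1 p.2)
    fun t a b hab => Finset.sum_le_sum fun p _ => hmono _ _ _ hab]
  refine Finset.sum_congr rfl fun t _ => ?_
  rw [← ENNReal.finsetSum_iSup_of_monotone (f := fun (p : Fin N × Fin N) n => gs n (Φ.flow t z) p.1 p.2)
    fun p a b hab => hmono _ _ _ hab]
  exact Finset.sum_congr rfl fun p _ => hsup _ _ _

end Good

/-! ### The three inputs and the assembly -/

/-- **INPUT `LB` (first-collision lower bound)**, dimension `d`: for `0 < ε < 1/2`, every flow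
structure, every measurable mark and every `τ > 0`, `ofReal τ * Flux(g) ≤ ∫⁻ CPS_{(0,τ]}(g) dLiouville`.
[cite: CIP1994, App. 4.A pp. 107–111] -/
theorem campbellLowerBound_iff (d : Type*) [Fintype d] :
    (∀ (N : ℕ) (ε : ℝ), 0 < ε → ε < 1 / 2 → ∀ (Φ : HardSphereFlow (Torus.geometry d) ε N)
      (g : Config N d (UnitAddTorus d) → Fin N → Fin N → ℝ≥0∞), (∀ i j, Measurable fun w => g w i j) →
      ∀ τ : ℝ, 0 < τ → ENNReal.ofReal τ * outgoingCollisionFlux ε N g ≤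
        ∫⁻ z, Φ.collisionPairSum (Ioc 0 τ) (fun _ w i j => g w i j) z ∂(liouville (Torus.geometry d) N ε)) ↔
    (∀ (N : ℕ) (ε : ℝ), 0 < ε → ε < 1 / 2 → ∀ (Φ : HardSphereFlow (Torus.geometry d) ε N)
      (g : Config N d (UnitAddTorus d) → Fin N → Fin N → ℝ≥0∞), (∀ i j, Measurable fun w => g w i j) →
      ∀ τ : ℝ, 0 < τ → ENNReal.ofReal τ * outgoingCollisionFlux ε N g ≤
        ∫⁻ z, Φ.collisionPairSum (Ioc 0 τ) (fun _ w i j => g w i j) z ∂(liouville (Torus.geometry d) N ε)) :=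
  Iff.rfl

/-- **Equality for marks dominated by an energy-shell mark.** In dimension `d`, assume the lower bound
`LB` for all measurable marks and the sharp upper bound with finiteness for the shell mark
`g₀ = c · 1{E ≤ E₀}`. Then every measurable `g ≤ g₀` satisfies `∫⁻ CPS_τ(g) = ofReal τ * Flux(g)`
(`τ > 0`): lower bounds for `g` and `g₀ − g`, additivity, and the finite upper bound for `g₀`.
[cite: CIP1994, App. 4.A pp. 107–111] -/
theorem lintegral_cps_eq_of_le_shell (hε : 0 < ε) (hε' : ε < 1 / 2)
    (Φ : HardSphereFlow (Torus.geometry d) ε N)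
    (hLB : ∀ (g : Config N d (UnitAddTorus d) → Fin N → Fin N → ℝ≥0∞), (∀ i j, Measurable fun w => g w i j) →
      ∀ τ : ℝ, 0 < τ → ENNReal.ofReal τ * outgoingCollisionFlux ε N g ≤
        ∫⁻ z, Φ.collisionPairSum (Ioc 0 τ) (fun _ w i j => g w i j) z ∂(liouville (Torus.geometry d) N ε))
    {E₀ : ℝ} {c : ℝ≥0} {τ : ℝ} (hτ : 0 < τ)
    (hUB : ∫⁻ z, Φ.collisionPairSum (Ioc 0 τ)
        (fun _ w _ _ => if configEnergy w ≤ E₀ then (c : ℝ≥0∞) else 0) z ∂(liouville (Torus.geometry d) N ε) ≤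
      ENNReal.ofReal τ * outgoingCollisionFlux ε N (fun (w : Config N d (UnitAddTorus d)) _ _ =>
            if configEnergy w ≤ E₀ then (c : ℝ≥0∞) else 0))
    (hfin : outgoingCollisionFlux ε N (fun (w : Config N d (UnitAddTorus d)) (_ _ : Fin N) =>
        if configEnergy w ≤ E₀ then (c : ℝ≥0∞) else 0) ≠ ⊤)
    {g : Config N d (UnitAddTorus d) → Fin N → Fin N → ℝ≥0∞} (hg : ∀ i j, Measurable fun w => g w i j)
    (hle : ∀ w i j, g w i j ≤ if configEnergy w ≤ E₀ then (c : ℝ≥0∞) else 0) :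
    ∫⁻ z, Φ.collisionPairSum (Ioc 0 τ) (fun _ w i j => g w i j) z ∂(liouville (Torus.geometry d) N ε) =
      ENNReal.ofReal τ * outgoingCollisionFlux ε N g := by
  have _ := hε
  have _ := hε'
  -- the complementary mark
  set s : Config N d (UnitAddTorus d) → Fin N → Fin N → ℝ≥0∞ :=
    fun w _ _ => if configEnergy w ≤ E₀ then (c : ℝ≥0∞) else 0 with hsdef
  have hsm : ∀ i j : Fin N, Measurable fun w => s w i j := fun i j =>
    Measurable.ite (measurableSet_le measurable_configEnergy_torus measurable_const) measurable_const
      measurable_const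
  set g' : Config N d (UnitAddTorus d) → Fin N → Fin N → ℝ≥0∞ := fun w i j => s w i j - g w i j with hg'def
  have hg'm : ∀ i j, Measurable fun w => g' w i j := fun i j => (hsm i j).sub (hg i j)
  have hsum : ∀ w i j, g w i j + g' w i j = s w i j := fun w i j => add_tsub_cancel_of_le (hle w i j)
  -- the two lower bounds, additivity on both sides, the upper bound
  have hA := hLB g hg τ hτ
  have hB := hLB g' hg'm τ hτ
  have hflux : outgoingCollisionFlux ε N s = outgoingCollisionFlux ε N g + outgoingCollisionFlux ε N g' := by
    rw [← outgoingCollisionFlux_add (g' := g') ε N hg]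
    congr 1
    funext w i j
    exact (hsum w i j).symm
  refine eq_of_sandwich_ennreal hA hB ?_ ?_
  · calc (∫⁻ z, Φ.collisionPairSum (Ioc 0 τ) (fun _ w i j => g w i j) z ∂(liouville (Torus.geometry d) N ε)) +
          ∫⁻ z, Φ.collisionPairSum (Ioc 0 τ) (fun _ w i j => g' w i j) z ∂(liouville (Torus.geometry d) N ε)
        ≤ ∫⁻ z, (Φ.collisionPairSum (Ioc 0 τ) (fun _ w i j => g w i j) z +
            Φ.collisionPairSum (Ioc 0 τ) (fun _ w i j => g' w i j) z) ∂(liouville (Torus.geometry d) N ε) :=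
          le_lintegral_add _ _
      _ = ∫⁻ z, Φ.collisionPairSum (Ioc 0 τ) (fun _ w i j => s w i j) z ∂(liouville (Torus.geometry d) N ε) := by
          refine lintegral_congr_ae ?_
          filter_upwards [Φ.ae_mem_good] with z hz
          rw [← collisionPairSum_add_good Φ hz τ g g']
          unfold HardSphereFlow.collisionPairSum
          simp only [hsum]
      _ ≤ ENNReal.ofReal τ * outgoingCollisionFlux ε N s := hUB
      _ = _ := by rw [hflux, mul_add]
  · rw [← mul_add, ← hflux]
    exact ENNReal.mul_ne_top ENNReal.ofReal_ne_top hfin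

/-- **Assembly of the Campbell identity in dimension `d`** from the lower bound `LB`, the shell upper
bound `UB` (with finiteness) and the a.e. measurability `AEM` of collision pair sums: for a general
measurable mark `g`, the truncations `gₙ = min(g, n) · 1{E ≤ n} ↑ g` are dominated by shell marks, so
`∫⁻ CPS(gₙ) = τ Flux(gₙ)` (`lintegral_cps_eq_of_le_shell`); monotone convergence on the collision side
(`AEM`, finiteness of collision times on good orbits), monotonicity of the flux and `LB` for `g` give
`∫⁻ CPS(g) = τ Flux(g)`; for `τ ≤ 0` both sides vanish. [cite: CIP1994, App. 4.A pp. 107–111] -/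
theorem hardSphereCampbellFormula_dim_of (d : Type*) [Fintype d]
    (hLB : ∀ (N : ℕ) (ε : ℝ), 0 < ε → ε < 1 / 2 → ∀ (Φ : HardSphereFlow (Torus.geometry d) ε N)
      (g : Config N d (UnitAddTorus d) → Fin N → Fin N → ℝ≥0∞), (∀ i j, Measurable fun w => g w i j) →
      ∀ τ : ℝ, 0 < τ → ENNReal.ofReal τ * outgoingCollisionFlux ε N g ≤
        ∫⁻ z, Φ.collisionPairSum (Ioc 0 τ) (fun _ w i j => g w i j) z ∂(liouville (Torus.geometry d) N ε))
    (hUB : ∀ (N : ℕ) (ε : ℝ), 0 < ε → ε < 1 / 2 → ∀ (Φ : HardSphereFlow (Torus.geometry d) ε N)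
      (E₀ : ℝ) (c : ℝ≥0) (τ : ℝ), 0 < τ →
      (∫⁻ z, Φ.collisionPairSum (Ioc 0 τ)
          (fun _ w _ _ => if configEnergy w ≤ E₀ then (c : ℝ≥0∞) else 0) z ∂(liouville (Torus.geometry d) N ε) ≤
        ENNReal.ofReal τ *
          outgoingCollisionFlux ε N (fun (w : Config N d (UnitAddTorus d)) _ _ =>
            if configEnergy w ≤ E₀ then (c : ℝ≥0∞) else 0)) ∧
      outgoingCollisionFlux ε N (fun (w : Config N d (UnitAddTorus d)) (_ _ : Fin N) =>
        if configEnergy w ≤ E₀ then (c : ℝ≥0∞) else 0) ≠ ⊤)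
    (hAEM : ∀ (N : ℕ) (ε : ℝ), 0 < ε → ε < 1 / 2 → ∀ (Φ : HardSphereFlow (Torus.geometry d) ε N)
      (g : Config N d (UnitAddTorus d) → Fin N → Fin N → ℝ≥0∞), (∀ i j, Measurable fun w => g w i j) →
      ∀ τ : ℝ, AEMeasurable (Φ.collisionPairSum (Ioc 0 τ) (fun _ w i j => g w i j))
        (liouville (Torus.geometry d) N ε))
    (N : ℕ) (ε : ℝ) (hε : 0 < ε) (hε' : ε < 1 / 2) (Φ : HardSphereFlow (Torus.geometry d) ε N)
    (g : Config N d (UnitAddTorus d) → Fin N → Fin N → ℝ≥0∞) (hg : ∀ i j, Measurable fun w => g w i j)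
    (τ : ℝ) :
    ∫⁻ z, Φ.collisionPairSum (Ioc 0 τ) (fun _ w i j => g w i j) z ∂(liouville (Torus.geometry d) N ε) =
      ENNReal.ofReal τ * outgoingCollisionFlux ε N g := by
  rcases le_or_gt τ 0 with hτ | hτ
  · -- empty window
    have h0 : ∀ z, Φ.collisionPairSum (Ioc 0 τ) (fun _ w i j => g w i j) z = 0 := fun z => by
      unfold HardSphereFlow.collisionPairSum
      rw [Ioc_eq_empty (not_lt.2 hτ), collisionPairSum_empty]
    simp only [h0, lintegral_zero, ENNReal.ofReal_of_nonpos hτ, zero_mul]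
  -- the truncations
  set gs : ℕ → Config N d (UnitAddTorus d) → Fin N → Fin N → ℝ≥0∞ :=
    fun n w i j => if configEnergy w ≤ n then min (g w i j) n else 0 with hgsdef
  have hgsm : ∀ n i j, Measurable fun w => gs n w i j := fun n i j =>
    Measurable.ite (measurableSet_le measurable_configEnergy_torus measurable_const)
      ((hg i j).min measurable_const) measurable_const
  have hgs_le : ∀ n w i j, gs n w i j ≤ if configEnergy w ≤ (n : ℝ) then ((n : ℝ≥0) : ℝ≥0∞) else 0 := by
    intro n w i j
    simp only [hgsdef]
    split_ifs
    · exact (min_le_right _ _).trans_eq (ENNReal.coe_natCast n).symm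
    · exact le_rfl
  have hgs_le_g : ∀ n w i j, gs n w i j ≤ g w i j := by
    intro n w i j
    simp only [hgsdef]
    split_ifs
    · exact min_le_left _ _
    · exact bot_le
  have hmono : ∀ w i j, Monotone fun n => gs n w i j := by
    intro w i j a b hab
    simp only [hgsdef]
    by_cases ha : configEnergy w ≤ (a : ℝ)
    · have hb : configEnergy w ≤ (b : ℝ) := ha.trans (by exact_mod_cast hab)
      rw [if_pos ha, if_pos hb]
      exact min_le_min le_rfl (by exact_mod_cast hab)
    · rw [if_neg ha]
      exact bot_le
  have hsup : ∀ w i j, ⨆ n, gs n w i j = g w i j := by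
    intro w i j
    refine le_antisymm (iSup_le fun n => hgs_le_g n w i j) ?_
    -- along `n → ∞` the truncation releases: energy below `n`, and `min (g, n) → g`
    obtain ⟨n₀, hn₀⟩ := exists_nat_ge (configEnergy w)
    refine le_of_forall_lt fun r hr => ?_
    obtain ⟨m, hm⟩ : ∃ m : ℕ, r < (m : ℝ≥0∞) := ENNReal.exists_nat_gt (ne_top_of_lt hr)
    refine lt_of_lt_of_le (lt_min hr hm) ((le_iSup (fun n => gs n w i j) (max n₀ m)).trans' ?_)
    simp only [hgsdef]
    rw [if_pos (hn₀.trans (by exact_mod_cast le_max_left n₀ m))]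
    exact min_le_min le_rfl (by exact_mod_cast le_max_right n₀ m)
  -- equality for each truncation
  have heq : ∀ n : ℕ, ∫⁻ z, Φ.collisionPairSum (Ioc 0 τ) (fun _ w i j => gs n w i j) z
      ∂(liouville (Torus.geometry d) N ε) = ENNReal.ofReal τ * outgoingCollisionFlux ε N (gs n) := by
    intro n
    obtain ⟨hub, hfin⟩ := hUB N ε hε hε' Φ n n τ hτ
    exact lintegral_cps_eq_of_le_shell hε hε' Φ (hLB N ε hε hε' Φ) hτ hub hfin (hgsm n) (hgs_le n)
  -- monotone convergence on the collision side
  have hlhs : ∫⁻ z, Φ.collisionPairSum (Ioc 0 τ) (fun _ w i j => g w i j) z ∂(liouville (Torus.geometry d) N ε) =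
      ⨆ n, ∫⁻ z, Φ.collisionPairSum (Ioc 0 τ) (fun _ w i j => gs n w i j) z ∂(liouville (Torus.geometry d) N ε) := by
    rw [← lintegral_iSup' (fun n => hAEM N ε hε hε' Φ (gs n) (hgsm n) τ)]
    · refine lintegral_congr_ae ?_
      filter_upwards [Φ.ae_mem_good] with z hz
      exact (iSup_collisionPairSum_good Φ hz τ gs hmono g hsup).symm
    · filter_upwards [Φ.ae_mem_good] with z hz
      intro a b hab
      unfold HardSphereFlow.collisionPairSum
      simp only [collisionPairSum_eq_finset_sum (finite_collisionTimes_Ioc Φ hz τ)]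
      exact Finset.sum_le_sum fun t _ => Finset.sum_le_sum fun p _ => hmono _ _ _ hab
  refine le_antisymm ?_ (hLB N ε hε hε' Φ g hg τ hτ)
  rw [hlhs]
  refine iSup_le fun n => ?_
  rw [heq n]
  exact mul_le_mul' le_rfl (outgoingCollisionFlux_mono ε N (hgs_le_g n))

end

end Literature.MathematicalPhysics.KineticTheory
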